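import Literature.Geometry.Lorentzian.CoordGaussianSliceCodazzi
import Literature.Geometry.Lorentzian.CoordCurvatureNormSq
import HarnessLib

/-!
# The Kretschmann scalar at the points of a Gaussian slice

Companion of `CoordGaussianSlice.lean` / `CoordGaussianSliceCodazzi.lean` (Gauss, Codazzi and
normal components of `R = riemAt G` at the points `(0, y)`, `y ∈ B`, of a slice along which the
metric components `G` on `ℝ × F` are Gaussian to second order) and of `CoordCurvatureNormSq.lean`
(the square norm `rmNormSqAt G x = |Rm|²_G = R_{abcd}R^{abcd}`, `rmNormSqAt_eq_sum`; in an
orthonormal basis of a definite `G x` a sum of squares, `rmNormSqAt_eq_sum_sq`). Here the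
**indefinite** case is treated: in a pseudo-orthonormal basis `e` of `G x`
(`G(e_a, e_c) = ε_a δ_{ac}`, `ε_a = ±1`)

  `|Rm|²_G = Σ_{acij} ε_a ε_c ε_i ε_j G(R(e_a,e_c)e_i, e_j)²`  (`rmNormSqAt_eq_sum_sq_signed`),

and at a slice point, in the adapted basis `(e₀, b̃₁, …, b̃ₙ)` of an `h`-orthonormal basis `b` of
`F` (`ε₀ = −1`), sorting by the number of time slots (three or more vanish, the pairs `(e₀,e₀)` in
the first or in the last two slots vanish) gives the **split of the Kretschmann scalar**

  `|Rm|²_G (0,y) = |𝒢|² − 2|𝒞|² − 2|𝒞ᵗ|² + 4|𝒩|²`  (`rmNormSqAt_svec_eq`)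

with the Gauss block `𝒢(a,c,i,j) = G(R(b̃_a,b̃_c)b̃_i, b̃_j)` (`apply_riemAt_svec`), the Codazzi
blocks `𝒞(a,c,i) = G(R(b̃_a,b̃_c)b̃_i, e₀)`, `𝒞ᵗ(c,i,j) = G(R(e₀,b̃_c)b̃_i, b̃_j)`
(`CoordGaussianSliceCodazzi.lean`; `|𝒞ᵗ|² = |𝒞|²` by pair symmetry, `rmNormSqAt_svec_eq'`) and the
normal block `𝒩(c,i) = G(R(e₀,b̃_c)b̃_i, e₀)` (`apply_riemAt_tvec`), all sums of squares over `b`.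
This is the `1+3` form `K₁ = 4[Tr ℰ² − 2 Tr ℋ·ℋᵀ + Tr ℱ²]` of the Kretschmann invariant
(Cherubini–Bini–Capozziello–Ruffini 2002, §2.2: `ℰ ↔ 𝒩`, `ℋ` the spatial dual of `𝒞`,
`ℱ` the double spatial dual of `𝒢`), written without duals. Consequences:

* `apply_riemAt_tvec_eq_ricAt` — the normal block without second time derivatives:
  `𝒩(v,w) = Ric_h(v,w) + (tr_h K) K(v,w) − K(w, ♯_h K(v,·)) − Ric_G(ṽ,w̃)` (eliminating
  `½∂_t∂_t G(ṽ,w̃)` between `apply_riemAt_tvec` and `ricAt_svec_svec`), so that **in vacuum**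
  (`Ric_G(ṽ,w̃) = 0`) `𝒩 = Ric_h + (tr_h K) K − K∘♯K` is a polynomial in the slice data
  (`apply_riemAt_tvec_of_ricAt_eq_zero`);
* `rmNormSqAt_svec_ge` — dropping the Gauss square, `4|𝒩|² − 2|𝒞|² − 2|𝒞ᵗ|² ≤ |Rm|²_G (0,y)`,
  and `4(|𝒩|² − |𝒞|²) ≤ |Rm|²_G (0,y)` (`rmNormSqAt_svec_ge'`).

Everything is proved; no definition and no statement of `Prop` type is introduced (the sign
vector of the adapted basis is written inline as `Option.elim · (−1) (fun _ ↦ 1)`).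

## References

* C. Cherubini, D. Bini, S. Capozziello, R. Ruffini, *Second order scalar invariants of the
  Riemann tensor: applications to black hole spacetimes*, Int. J. Mod. Phys. D 11 (2002)
  827–841, arXiv:gr-qc/0302095, §2.2 (the `1+3` splitting `ℰ, ℋ, ℱ` of the Riemann tensor and
  `K₁ = 4[Tr ℰ² − 2 Tr ℋ·ℋᵀ + Tr ℱ²]`). [CherubiniEtAl2002]
* P. Topping, *Lectures on the Ricci flow*, LMS Lecture Note Series 325, CUP 2006, §3.2, (3.2.4)
  (`|Rm|²`). [Topping2006]
* B. O'Neill, *Semi-Riemannian geometry with applications to relativity*, Academic Press 1983,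
  Ch. 2, Lemmas 2.24–2.25 (orthonormal bases, `ε_j = ⟨e_j, e_j⟩`), Ch. 3, Prop. 3.36, pp. 60–61;
  Ch. 4, Thm. 4.5, Prop. 4.33. [ONeill1983]
* R. M. Wald, *General Relativity*, Chicago 1984, §10.2, (10.2.23)–(10.2.27). [Wald1984]
-/

noncomputable section

set_option maxSynthPendingDepth 3

open Set Filter ContinuousLinearMap Module
open scoped Topology ContDiff

namespace Literature.Geometry.Lorentzian

namespace MetricCoord

/-! ### Pseudo-orthonormal bases of an indefinite form -/

section PseudoOrthonormal

variable {E : Type*} [NormedAddCommGroup E] [NormedSpace ℝ E] {ι : Type*} [Fintype ι] [DecidableEq ι]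
  {G : E → E →L[ℝ] E →L[ℝ] ℝ} {V : Set E} {x : E}
  (e : Basis ι ℝ E) (ε : ι → ℝ) (hε : ∀ i, ε i * ε i = 1)
  (he : ∀ i j, G x (e i) (e j) = if i = j then ε i else 0)
include he

/-- In a pseudo-orthonormal basis (`G(e_i, e_j) = ε_i δ_{ij}`): `G(v, e_i) = ε_i eⁱ(v)`.
[cite: ONeill1983, Ch. 2, Lemma 2.25] -/
theorem apply_basis_of_pseudoOrthonormal (v : E) (i : ι) : G x v (e i) = ε i * e.coord i v := by
  classical
  conv_lhs => rw [← e.sum_repr v]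
  rw [map_sum, _root_.sum_apply]
  simp only [map_smul, _root_.smul_apply, smul_eq_mul, he, mul_ite, mul_zero,
    Finset.sum_ite_eq', Finset.mem_univ, if_true, Basis.coord_apply]
  ring

include hε

/-- In a pseudo-orthonormal basis the dual basis is `eⁱ = ε_i G(·, e_i)` (O'Neill 1983, Ch. 2,
Lemma 2.25: `v = Σ ε_j ⟨v, e_j⟩ e_j`). [cite: ONeill1983, Ch. 2, Lemma 2.25] -/
theorem coord_eq_of_pseudoOrthonormal (v : E) (i : ι) : e.coord i v = ε i * G x v (e i) := by
  rw [apply_basis_of_pseudoOrthonormal e ε he, ← mul_assoc, hε, one_mul]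

/-- **Expansion in a pseudo-orthonormal basis**: `v = Σ_i ε_i G(v, e_i) e_i`.
[cite: ONeill1983, Ch. 2, Lemma 2.25] -/
theorem sum_apply_smul_of_pseudoOrthonormal (v : E) : ∑ i, (ε i * G x v (e i)) • e i = v := by
  conv_rhs => rw [← e.sum_repr v]
  exact Finset.sum_congr rfl fun i _ ↦ by
    rw [← coord_eq_of_pseudoOrthonormal e ε hε he, Basis.coord_apply]

variable [FiniteDimensional ℝ E]

/-- In a pseudo-orthonormal basis `g^{ij} = ε_i δ^{ij}`. [cite: ONeill1983, Ch. 3, p. 60] -/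
theorem ginv_of_pseudoOrthonormal (hx : (G x).IsInvertible) (i j : ι) :
    ginv G e x i j = if i = j then ε i else 0 := by
  classical
  have h := coord_eq_sum_ginv e hx (e j) i
  simp only [he, mul_ite, mul_zero, Finset.sum_ite_eq, Finset.mem_univ, if_true] at h
  have h2 : ginv G e x i j = ginv G e x i j * ε j * ε j := by rw [mul_assoc, hε, mul_one]
  rw [h2, ← h, Basis.coord_apply, e.repr_self, Finsupp.single_apply]
  by_cases hij : i = j
  · subst hij; simp
  · simp [hij, Ne.symm hij]

/-- `Σ_{a'} g^{aa'} F(a') = ε_a F(a)` in a pseudo-orthonormal basis (contraction with `g^{aa'} = ε_a δ^{aa'}`,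
O'Neill 1983, Ch. 3, p. 60). [cite: ONeill1983, Ch. 3, p. 60] -/
theorem sum_ginv_mul_of_pseudoOrthonormal (hx : (G x).IsInvertible) (F : ι → ℝ) (a : ι) :
    ∑ a', ginv G e x a a' * F a' = ε a * F a := by
  simp only [ginv_of_pseudoOrthonormal e ε hε he hx, ite_mul, zero_mul, Finset.sum_ite_eq,
    Finset.mem_univ, if_true]

/-- **The trace in a pseudo-orthonormal basis**: `tr A = Σ_i ε_i G(A e_i, e_i)`.
[cite: ONeill1983, Ch. 3, p. 60] -/
theorem traceCLM_eq_sum_of_pseudoOrthonormal (A : E →L[ℝ] E) :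
    traceCLM E A = ∑ i, ε i * G x (A (e i)) (e i) := by
  rw [traceCLM_apply, trace_eq_sum_coord e]
  exact Finset.sum_congr rfl fun i _ ↦ by
    rw [ContinuousLinearMap.coe_coe, coord_eq_of_pseudoOrthonormal e ε hε he]

omit [FiniteDimensional ℝ E] in
/-- **Composition in a pseudo-orthonormal basis**:
`G(A B e_i, e_j) = Σ_m ε_m G(B e_i, e_m) G(A e_m, e_j)`. [cite: ONeill1983, Ch. 3, p. 60] -/
theorem apply_comp_of_pseudoOrthonormal (A B : E →L[ℝ] E) (i j : ι) :
    G x (A (B (e i))) (e j) = ∑ m, ε m * G x (B (e i)) (e m) * G x (A (e m)) (e j) := by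
  conv_lhs => rw [← sum_apply_smul_of_pseudoOrthonormal e ε hε he (B (e i))]
  rw [map_sum, map_sum, _root_.sum_apply]
  exact Finset.sum_congr rfl fun m _ ↦ by
    rw [map_smul, map_smul, _root_.smul_apply, smul_eq_mul]

variable [CompleteSpace E]

/-- **`|Rm|²` in a pseudo-orthonormal basis**:
`|Rm|²_G = Σ_{acij} ε_a ε_c ε_i ε_j G(R(e_a,e_c)e_i, e_j)²` — Topping's
`|Rm|² = g^{aa'}g^{cc'}g^{ii'}g^{jj'} R_{acij} R_{a'c'i'j'}` with `g^{aa'} = ε_a δ^{aa'}`; the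
indefinite-signature form of `IsMetricOn.rmNormSqAt_eq_sum_sq`. [cite: Topping2006, §3.2, (3.2.4)] -/
theorem IsMetricOn.rmNormSqAt_eq_sum_sq_signed (hG : IsMetricOn G V) (hx : x ∈ V) :
    rmNormSqAt G x = ∑ a, ∑ c, ∑ i, ∑ j,
      ε a * ε c * ε i * ε j * (G x (riemAt G x (e a) (e c) (e i)) (e j)) ^ 2 := by
  have hi := hG.isInvertible x hx
  rw [rmNormSqAt_eq_sum e]
  have h1 : ∀ a, ∑ a', ∑ c, ∑ c', ginv G e x a a' * ginv G e x c c' *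
      traceCLM E ((riemAt G x (e a) (e c)).comp (riemAt G x (e a') (e c'))) =
      ε a * ∑ c, ε c * traceCLM E ((riemAt G x (e a) (e c)).comp (riemAt G x (e a) (e c))) := by
    intro a
    calc ∑ a', ∑ c, ∑ c', ginv G e x a a' * ginv G e x c c' *
          traceCLM E ((riemAt G x (e a) (e c)).comp (riemAt G x (e a') (e c')))
        = ∑ a', ginv G e x a a' * ∑ c, ∑ c', ginv G e x c c' *
            traceCLM E ((riemAt G x (e a) (e c)).comp (riemAt G x (e a') (e c'))) := by
          refine Finset.sum_congr rfl fun a' _ ↦ ?_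
          rw [Finset.mul_sum]
          refine Finset.sum_congr rfl fun c _ ↦ ?_
          rw [Finset.mul_sum]
          exact Finset.sum_congr rfl fun c' _ ↦ by ring
      _ = ε a * ∑ c, ∑ c', ginv G e x c c' *
            traceCLM E ((riemAt G x (e a) (e c)).comp (riemAt G x (e a) (e c'))) :=
          sum_ginv_mul_of_pseudoOrthonormal e ε hε he hi _ a
      _ = _ := by
          congr 1
          exact Finset.sum_congr rfl fun c _ ↦ sum_ginv_mul_of_pseudoOrthonormal e ε hε he hi _ c
  simp only [h1]
  simp only [traceCLM_eq_sum_of_pseudoOrthonormal e ε hε he, ContinuousLinearMap.comp_apply,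
    apply_comp_of_pseudoOrthonormal e ε hε he, Finset.mul_sum, ← Finset.sum_neg_distrib]
  refine Finset.sum_congr rfl fun a _ ↦ Finset.sum_congr rfl fun c _ ↦
    Finset.sum_congr rfl fun i _ ↦ Finset.sum_congr rfl fun j _ ↦ ?_
  rw [hG.apply_riemAt_swap hx (e a) (e c) (e i) (e j)]
  ring

omit [FiniteDimensional ℝ E] [Fintype ι] [DecidableEq ι] hε he in
/-- `G(R(X,Y)Z, Z) = 0`: the curvature endomorphism is `G`-skew-adjoint.
[cite: ONeill1983, Ch. 3, Prop. 3.36 (2)] -/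
theorem IsMetricOn.apply_riemAt_self_right (hG : IsMetricOn G V) (hx : x ∈ V) (X Y Z : E) :
    G x (riemAt G x X Y Z) Z = 0 := by
  have h := hG.apply_riemAt_swap hx X Y Z Z
  linarith

end PseudoOrthonormal

namespace GaussSlice

variable {F : Type*} [NormedAddCommGroup F] [NormedSpace ℝ F]
  {G : ℝ × F → (ℝ × F) →L[ℝ] (ℝ × F) →L[ℝ] ℝ} {T : Set (ℝ × F)} {B : Set F} {y : F}

/-! ### The normal block without second time derivatives -/

section NormalBlock

variable [FiniteDimensional ℝ F] [CompleteSpace F] (hG : IsMetricOn G T) (hS : IsGaussianSlice G B)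
include hG hS

/-- **The normal curvature block in terms of the slice data and the Ricci tensor**:
`G(R(e₀,ṽ)w̃, e₀) = Ric_h(v,w) + (tr_h K) K(v,w) − K(w, ♯_h K(v,·)) − Ric_G(ṽ,w̃)` on the slice —
the second time derivative `½ ∂_t∂_t G(ṽ,w̃)` of `apply_riemAt_tvec` eliminated with
`ricAt_svec_svec` (Wald 1984, (10.2.25)–(10.2.27) combined with the definition of `R_{0i0j}`).
[cite: Wald1984, (10.2.25)–(10.2.27)] -/
theorem apply_riemAt_tvec_eq_ricAt (hB : IsOpen B) (hBT : ∀ y ∈ B, svec y ∈ T) (hy : y ∈ B)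
    (v w : F) :
    G (svec y) (riemAt G (svec y) tvec (svec v) (svec w)) tvec =
      ricAt (sliceMetric G) y v w + mtrAt (sliceMetric G) y (sliceK G y) * sliceK G y v w
        - sliceK G y w (sharpAt (sliceMetric G) y (sliceK G y v))
        - ricAt G (svec y) (svec v) (svec w) := by
  rw [apply_riemAt_tvec hG hS hB hBT hy, ricAt_svec_svec hG hS hB hBT hy]
  ring

/-- **The normal block in vacuum**: if `Ric_G(ṽ, w̃) = 0` then
`G(R(e₀,ṽ)w̃, e₀) = Ric_h(v,w) + (tr_h K) K(v,w) − K(w, ♯_h K(v,·))`, a polynomial in the slice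
data `(h, K)` and the curvature of `h` (the "electric" combination `Ric_h + (tr K)K − K∘♯K` of the
vacuum constraint/evolution system, Wald 1984, (10.2.25)–(10.2.27)).
[cite: Wald1984, (10.2.25)–(10.2.27)] -/
theorem apply_riemAt_tvec_of_ricAt_eq_zero (hB : IsOpen B) (hBT : ∀ y ∈ B, svec y ∈ T)
    (hy : y ∈ B) {v w : F} (hRic : ricAt G (svec y) (svec v) (svec w) = 0) :
    G (svec y) (riemAt G (svec y) tvec (svec v) (svec w)) tvec =
      ricAt (sliceMetric G) y v w + mtrAt (sliceMetric G) y (sliceK G y) * sliceK G y v w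
        - sliceK G y w (sharpAt (sliceMetric G) y (sliceK G y v)) := by
  rw [apply_riemAt_tvec_eq_ricAt hG hS hB hBT hy, hRic, sub_zero]

end NormalBlock

/-! ### Components with two time slots -/

section TwoTime

variable [CompleteSpace F] (hG : IsMetricOn G T)
include hG

/-- `G(R(e₀, ṽ)e₀, z̃) = −G(R(e₀, ṽ)z̃, e₀)` (skew-adjointness; the right-hand side is the normal
block `apply_riemAt_tvec`). [cite: ONeill1983, Ch. 3, Prop. 3.36 (2)] -/
theorem apply_riemAt_tvec_svec_tvec_svec (hBT : ∀ y ∈ B, svec y ∈ T) (hy : y ∈ B) (v z : F) :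
    G (svec y) (riemAt G (svec y) tvec (svec v) tvec) (svec z) =
      -G (svec y) (riemAt G (svec y) tvec (svec v) (svec z)) tvec :=
  hG.apply_riemAt_swap (hBT y hy) tvec (svec v) (svec z) tvec

/-- `G(R(ṽ, e₀)e₀, z̃) = G(R(e₀, ṽ)z̃, e₀)` (both skew-symmetries).
[cite: ONeill1983, Ch. 3, Prop. 3.36] -/
theorem apply_riemAt_svec_tvec_tvec_svec (hBT : ∀ y ∈ B, svec y ∈ T) (hy : y ∈ B) (v z : F) :
    G (svec y) (riemAt G (svec y) (svec v) tvec tvec) (svec z) =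
      G (svec y) (riemAt G (svec y) tvec (svec v) (svec z)) tvec := by
  rw [riemAt_swap G (svec y) tvec (svec v), _root_.neg_apply, map_neg, _root_.neg_apply,
    apply_riemAt_tvec_svec_tvec_svec hG hBT hy, neg_neg]

omit [CompleteSpace F] hG in
/-- `G(R(ṽ, e₀)w̃, e₀) = −G(R(e₀, ṽ)w̃, e₀)` (skew-symmetry). [cite: ONeill1983, Ch. 3, Prop. 3.36 (1)] -/
theorem apply_riemAt_svec_tvec_svec_tvec (v w : F) :
    G (svec y) (riemAt G (svec y) (svec v) tvec (svec w)) tvec =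
      -G (svec y) (riemAt G (svec y) tvec (svec v) (svec w)) tvec := by
  rw [riemAt_swap G (svec y) tvec (svec v), _root_.neg_apply, map_neg, _root_.neg_apply]

end TwoTime

/-! ### The split of the Kretschmann scalar at slice points -/

section Kretschmann

variable [FiniteDimensional ℝ F] [CompleteSpace F] {ι : Type*} [Fintype ι] [DecidableEq ι]
  (b : Basis ι ℝ F) (hb : ∀ i j, sliceMetric G y (b i) (b j) = if i = j then 1 else 0)
  (hG : IsMetricOn G T) (hS : IsGaussianSlice G B)
include hb hG hS

omit [FiniteDimensional ℝ F] [CompleteSpace F] [Fintype ι] in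
/-- **The adapted basis of an `h`-orthonormal basis is pseudo-orthonormal** on the slice:
`G(e₀,e₀) = −1`, `G(e₀, b̃_j) = 0`, `G(b̃_i, b̃_j) = δ_{ij}` (O'Neill 1983, Ch. 2, Lemma 2.24 ff.,
with `ε₀ = −1`). [cite: Wald1984, §3.3] -/
theorem apply_sliceBasis (hBT : ∀ y ∈ B, svec y ∈ T) (hy : y ∈ B) (a c : Option ι) :
    G (svec y) (sliceBasis b a) (sliceBasis b c) =
      if a = c then Option.elim a (-1 : ℝ) (fun _ ↦ 1) else 0 := by
  have hb' : ∀ i j, G (svec y) (svec (b i)) (svec (b j)) = if i = j then 1 else 0 :=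
    fun i j ↦ by rw [← sliceMetric_apply]; exact hb i j
  rcases a with _ | i <;> rcases c with _ | j
  · simp [hS.g00 y hy]
  · simp [hS.g0x y hy]
  · simp [gx0 hG hS hBT hy]
  · simp [hb' i j]

/-- **`|Rm|²` at a slice point in the adapted basis**, signed sum of squares:
`|Rm|²_G (0,y) = Σ_{acij} ε_a ε_c ε_i ε_j G(R(E_a,E_c)E_i, E_j)²` over `E = (e₀, b̃₁, …, b̃ₙ)`,
`ε₀ = −1`, `ε_i = 1`. [cite: Topping2006, §3.2, (3.2.4)] -/
theorem rmNormSqAt_svec_eq_sum_sq_signed (hBT : ∀ y ∈ B, svec y ∈ T) (hy : y ∈ B) :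
    rmNormSqAt G (svec y) = ∑ a, ∑ c, ∑ i, ∑ j,
      Option.elim a (-1 : ℝ) (fun _ ↦ 1) * Option.elim c (-1 : ℝ) (fun _ ↦ 1)
        * Option.elim i (-1 : ℝ) (fun _ ↦ 1) * Option.elim j (-1 : ℝ) (fun _ ↦ 1)
        * (G (svec y) (riemAt G (svec y) (sliceBasis b a) (sliceBasis b c) (sliceBasis b i))
            (sliceBasis b j)) ^ 2 :=
  hG.rmNormSqAt_eq_sum_sq_signed (sliceBasis b) (fun a ↦ Option.elim a (-1 : ℝ) fun _ ↦ 1)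
    (fun a ↦ by cases a <;> simp) (apply_sliceBasis b hb hG hS hBT hy) (hBT y hy)

/-- **The split of the Kretschmann scalar at a slice point** (general, no field equations):
`|Rm|²_G (0,y) = |𝒢|² − 2|𝒞|² − 2|𝒞ᵗ|² + 4|𝒩|²`, the four blocks being the sums of squares over
an `h`-orthonormal basis `b` of the Gauss components `G(R(b̃_a,b̃_c)b̃_i, b̃_j)`, the Codazzi
components `G(R(b̃_a,b̃_c)b̃_i, e₀)` and `G(R(e₀,b̃_c)b̃_i, b̃_j)`, and the normal components
`G(R(e₀,b̃_c)b̃_i, e₀)`: in the signed sum of squares three or more time slots vanish, the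
time pairs in slots `(1,2)` or `(3,4)` vanish, each single time slot carries `ε₀ = −1` and each of
the four mixed time pairs reduces to `±𝒩`. This is `K₁ = 4[Tr ℰ² − 2 Tr ℋ·ℋᵀ + Tr ℱ²]`
(Cherubini–Bini–Capozziello–Ruffini 2002, §2.2) with `ℰ = 𝒩`, `ℋ` the spatial dual of `𝒞`
(`2 Tr ℋ·ℋᵀ = |𝒞|²`) and `ℱ` the double spatial dual of `𝒢` (`4 Tr ℱ² = |𝒢|²`).
[cite: CherubiniEtAl2002, §2.2] -/
theorem rmNormSqAt_svec_eq (hBT : ∀ y ∈ B, svec y ∈ T) (hy : y ∈ B) :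
    rmNormSqAt G (svec y) =
      (∑ a, ∑ c, ∑ i, ∑ j,
          (G (svec y) (riemAt G (svec y) (svec (b a)) (svec (b c)) (svec (b i))) (svec (b j))) ^ 2)
        - 2 * (∑ a, ∑ c, ∑ i,
          (G (svec y) (riemAt G (svec y) (svec (b a)) (svec (b c)) (svec (b i))) tvec) ^ 2)
        - 2 * (∑ c, ∑ i, ∑ j,
          (G (svec y) (riemAt G (svec y) tvec (svec (b c)) (svec (b i))) (svec (b j))) ^ 2)
        + 4 * ∑ c, ∑ i, (G (svec y) (riemAt G (svec y) tvec (svec (b c)) (svec (b i))) tvec) ^ 2 := by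
  have hx := hBT y hy
  rw [rmNormSqAt_svec_eq_sum_sq_signed b hb hG hS hBT hy]
  simp only [Fintype.sum_option, Option.elim, sliceBasis_none, sliceBasis_some, riemAt_self,
    _root_.zero_apply, map_zero,
    hG.apply_riemAt_self_right hx, apply_riemAt_svec_svec_tvec_svec hG hBT hy,
    apply_riemAt_svec_tvec_svec_svec, apply_riemAt_tvec_svec_tvec_svec hG hBT hy,
    apply_riemAt_svec_tvec_tvec_svec hG hBT hy, apply_riemAt_svec_tvec_svec_tvec,
    neg_sq, mul_one, one_mul, neg_mul, neg_neg, ne_eq, OfNat.ofNat_ne_zero,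
    not_false_eq_true, zero_pow, mul_zero, Finset.sum_const_zero, zero_add,
    Finset.sum_neg_distrib, Finset.sum_add_distrib]
  ring

omit [FiniteDimensional ℝ F] [DecidableEq ι] hb hS in
/-- **Pair symmetry identifies the two Codazzi blocks**: `|𝒞ᵗ|² = |𝒞|²`, since
`G(R(e₀,b̃_c)b̃_i, b̃_j) = −G(R(b̃_i,b̃_j)b̃_c, e₀)`. [cite: ONeill1983, Ch. 3, Prop. 3.36 (4)] -/
theorem sum_sq_apply_riemAt_tvec_svec_svec_svec (hBT : ∀ y ∈ B, svec y ∈ T) (hy : y ∈ B) :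
    ∑ c, ∑ i, ∑ j, (G (svec y) (riemAt G (svec y) tvec (svec (b c)) (svec (b i))) (svec (b j))) ^ 2 =
      ∑ a, ∑ c, ∑ i, (G (svec y) (riemAt G (svec y) (svec (b a)) (svec (b c)) (svec (b i))) tvec) ^ 2 := by
  have hx := hBT y hy
  calc ∑ c, ∑ i, ∑ j, (G (svec y) (riemAt G (svec y) tvec (svec (b c)) (svec (b i))) (svec (b j))) ^ 2
      = ∑ c, ∑ i, ∑ j,
          (G (svec y) (riemAt G (svec y) (svec (b i)) (svec (b j)) (svec (b c))) tvec) ^ 2 := by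
        refine Finset.sum_congr rfl fun c _ ↦ Finset.sum_congr rfl fun i _ ↦
          Finset.sum_congr rfl fun j _ ↦ ?_
        rw [hG.apply_riemAt_pair_comm hx tvec (svec (b c)) (svec (b i)) (svec (b j)),
          hG.apply_riemAt_swap hx (svec (b i)) (svec (b j)) (svec (b c)) tvec, neg_sq]
    _ = ∑ i, ∑ c, ∑ j,
          (G (svec y) (riemAt G (svec y) (svec (b i)) (svec (b j)) (svec (b c))) tvec) ^ 2 :=
        Finset.sum_comm
    _ = ∑ i, ∑ j, ∑ c,
          (G (svec y) (riemAt G (svec y) (svec (b i)) (svec (b j)) (svec (b c))) tvec) ^ 2 :=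
        Finset.sum_congr rfl fun i _ ↦ Finset.sum_comm

/-- **The split of the Kretschmann scalar, pair-symmetric form**:
`|Rm|²_G (0,y) = |𝒢|² − 4|𝒞|² + 4|𝒩|²`. [cite: CherubiniEtAl2002, §2.2] -/
theorem rmNormSqAt_svec_eq' (hBT : ∀ y ∈ B, svec y ∈ T) (hy : y ∈ B) :
    rmNormSqAt G (svec y) =
      (∑ a, ∑ c, ∑ i, ∑ j,
          (G (svec y) (riemAt G (svec y) (svec (b a)) (svec (b c)) (svec (b i))) (svec (b j))) ^ 2)
        - 4 * (∑ a, ∑ c, ∑ i,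
          (G (svec y) (riemAt G (svec y) (svec (b a)) (svec (b c)) (svec (b i))) tvec) ^ 2)
        + 4 * ∑ c, ∑ i, (G (svec y) (riemAt G (svec y) tvec (svec (b c)) (svec (b i))) tvec) ^ 2 := by
  rw [rmNormSqAt_svec_eq b hb hG hS hBT hy,
    sum_sq_apply_riemAt_tvec_svec_svec_svec b hG hBT hy]
  ring

/-- **Lower bound for the Kretschmann scalar at a slice point** (drop the Gauss square):
`4|𝒩|² − 2|𝒞|² − 2|𝒞ᵗ|² ≤ |Rm|²_G (0,y)`. [cite: CherubiniEtAl2002, §2.2] -/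
theorem rmNormSqAt_svec_ge (hBT : ∀ y ∈ B, svec y ∈ T) (hy : y ∈ B) :
    4 * (∑ c, ∑ i, (G (svec y) (riemAt G (svec y) tvec (svec (b c)) (svec (b i))) tvec) ^ 2)
        - 2 * (∑ a, ∑ c, ∑ i,
          (G (svec y) (riemAt G (svec y) (svec (b a)) (svec (b c)) (svec (b i))) tvec) ^ 2)
        - 2 * (∑ c, ∑ i, ∑ j,
          (G (svec y) (riemAt G (svec y) tvec (svec (b c)) (svec (b i))) (svec (b j))) ^ 2)
      ≤ rmNormSqAt G (svec y) := by
  rw [rmNormSqAt_svec_eq b hb hG hS hBT hy]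
  have h0 : 0 ≤ ∑ a, ∑ c, ∑ i, ∑ j,
      (G (svec y) (riemAt G (svec y) (svec (b a)) (svec (b c)) (svec (b i))) (svec (b j))) ^ 2 :=
    Finset.sum_nonneg fun _ _ ↦ Finset.sum_nonneg fun _ _ ↦ Finset.sum_nonneg fun _ _ ↦
      Finset.sum_nonneg fun _ _ ↦ sq_nonneg _
  linarith

/-- **Lower bound, pair-symmetric form**: `4(|𝒩|² − |𝒞|²) ≤ |Rm|²_G (0,y)`.
[cite: CherubiniEtAl2002, §2.2] -/
theorem rmNormSqAt_svec_ge' (hBT : ∀ y ∈ B, svec y ∈ T) (hy : y ∈ B) :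
    4 * ((∑ c, ∑ i, (G (svec y) (riemAt G (svec y) tvec (svec (b c)) (svec (b i))) tvec) ^ 2)
        - ∑ a, ∑ c, ∑ i,
          (G (svec y) (riemAt G (svec y) (svec (b a)) (svec (b c)) (svec (b i))) tvec) ^ 2)
      ≤ rmNormSqAt G (svec y) := by
  rw [rmNormSqAt_svec_eq' b hb hG hS hBT hy]
  have h0 : 0 ≤ ∑ a, ∑ c, ∑ i, ∑ j,
      (G (svec y) (riemAt G (svec y) (svec (b a)) (svec (b c)) (svec (b i))) (svec (b j))) ^ 2 :=
    Finset.sum_nonneg fun _ _ ↦ Finset.sum_nonneg fun _ _ ↦ Finset.sum_nonneg fun _ _ ↦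
      Finset.sum_nonneg fun _ _ ↦ sq_nonneg _
  linarith

end Kretschmann

end GaussSlice

end MetricCoord

end Literature.Geometry.Lorentzian

end
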